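import Summits.BirchSwinnertonDyer.BirchSwinnertonDyer.Theorems.GoldfeldAllTwistsTwoConverseTwinHalfTraceSevenModEightCore
import Literature.NumberTheory.EllipticCurves.HeegnerPointsGenusHalfTraceProofs
import HarnessLib

set_option linter.dupNamespace false -- namespace `…BirchSwinnertonDyer.BirchSwinnertonDyer…` is the cell's (D-0017 nested layout)
set_option autoImplicit false

/-!
# Heegner lifts under Shimura reciprocity: transport of partial sums over class cosets, the trace as
# «half-trace + θ(γ₀)(half-trace)», and the half-trace relation `Z + Z̄ = T` in `E(ℂ)` for `X₀(49)`

Cell `bsd-goldfeld`, seat `bsd-goldfeld-s1p-c201` (prover, gen 13), order `ROUTE-S1PLUS/planner-g30/c201_GO.txt`;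
`--supports stmt-BirchSwinnertonDyer-20044` (route decl
`Summit.BirchSwinnertonDyer.BirchSwinnertonDyer.Theses.GoldfeldAllTwistsTwoConverse.RankOneTwoConverseCMSevenAdditiveTwo`,
K12₂″). HONEST FRAMING: nothing here proves K12₂″ or BSD; the family `49a1^{(−q)}`, `q ≡ 5 (mod 8)` prime, has
twist-density zero (a witness family, never a closer of item 20044).

Theses-free; companion of the typer's `HeegnerPointsGenusHalfTraceProofs` (ty g12, p530330), whose §1
(`conjPoint_sum_φ_heegnerTau_sqCoset`: Gross 1991 Prop. 5.3 summed over a coset of `Cl²`, `[𝔫]` a square) and §2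
(`map_sq_sum_sqCoset`) are consumed BY NAME — no summed conjugation law is rebuilt here (one-proposer rule). What this
file adds, for a lift family `P : H.reps → E(H_K)` and an isomorphism `θ` with the transport law of the fact:
* §6 `θ(γ)` maps `Σ_{p([𝔞_q])} P_q` to `Σ_{p(γ⁻¹[𝔞_q])} P_q` (`map_sum_filter_eq_sum_filter_inv_mul`); if
  `[Cl : Cl²] = 2` and `γ₀ ∉ Cl²` then the complement of `Cl²` is `Cl²γ₀` (index-two bookkeeping, Mathlib
  `Subgroup.mul_mem_iff_of_index_two`) and **`Σ_q P_q = z + θ(γ₀) z`** for the half-trace `z = Σ_{[𝔞_q] ∈ Cl²} P_q`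
  (`sum_eq_halfTrace_add_map`); the partial sums map to the partial Heegner sums in `E(ℂ)` (`map_sum_filter_lifts`);
  `#{Q ∈ H.reps : [𝔞_Q] ∈ Cl²} = #Cl²` by the bijection `H.reps ≃ Cl` (`card_filter_sq_eq`); and, for Fricke sign `−1`,
  `#Cl²` odd and `φ(0) = T` with `2T = O`: **`Z + conj Z = T`** for `Z = Σ_{[𝔞_Q] ∈ Cl²} φ(τ_Q)` (`halfTrace_add_conj_eq_T`).
* §7 `Affine.Point.map` only depends on the underlying function / composites with three bases (folklore transport,
  used to move between `K`-linear and `ℚ`-linear maps without instance mismatches).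
The point `T = (2, −1) ∈ X₀(49)` and `2T = O` are seat c3x's `nonsingular_cm7_baseChange_two_neg_one` /
`cm7_twoTorsion_add_self` (`…TwinHalfTraceSevenModEightCore`, imported, not restated).

References: [GrossLMS1991] Prop. 5.3 and proof (PDF p. 220); [Darmon2004] Thm. 3.7; [Gross1984] §I.1;
[Cox2013] §3.B; [CremonaAlgorithms1997] Table 1 (N = 49).
-/

noncomputable section

open scoped Classical ComplexConjugate NNReal

open Literature.NumberTheory.EllipticCurves.ModularForms NumberField
open Literature.Computability.Cryptography.Hallgren2005
open Literature.Computability.Cryptography.Hallgren2005.OrderCl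
open Literature.NumberTheory.QuadraticFields.Quadratic

namespace Summit.BirchSwinnertonDyer.BirchSwinnertonDyer.Theorems.GoldfeldGoodTwists

open WeierstrassCurve Literature.NumberTheory.EllipticCurves

/-! ## §6 Heegner lifts: transport of partial sums, the half-trace and the trace -/

section Points

variable {N : ℕ} {W : WeierstrassCurve ℚ} {K : Type} [Field K] [NumberField K]

/-- **Transport of partial sums**: `θ(γ)` maps `Σ_{p([𝔞_q])} P_q` to `Σ_{p(γ⁻¹[𝔞_q])} P_q`. [cite: Darmon2004, Thm. 3.7] -/
theorem map_sum_filter_eq_sum_filter_inv_mul (hK : IsImaginaryQuadratic K) (H : HeegnerDatum N (NumberField.discr K))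
    (ι : K →+* ℂ) (P : H.reps → (W.baseChange (singularModuliField K ι)).toAffine.Point)
    (θ : ClassGroup (OrderCl.QO hK.negDiscr) ≃* Gal(singularModuliField K ι/K))
    (hθ : ∀ (γ : ClassGroup (OrderCl.QO hK.negDiscr)) (q : H.reps), ∃ q' : H.reps,
      heegnerFormClass hK q' = γ * heegnerFormClass hK q ∧
      Affine.Point.map (θ γ : singularModuliField K ι →ₐ[K] singularModuliField K ι) (P q) = P q')
    (γ : ClassGroup (OrderCl.QO hK.negDiscr)) (p : ClassGroup (OrderCl.QO hK.negDiscr) → Prop) :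
    Affine.Point.map (θ γ : singularModuliField K ι →ₐ[K] singularModuliField K ι)
        (∑ q ∈ Finset.univ.filter (fun q : H.reps ↦ p (heegnerFormClass hK q)), P q) =
      ∑ q ∈ Finset.univ.filter (fun q : H.reps ↦ p (γ⁻¹ * heegnerFormClass hK q)), P q := by
  set F := Finset.univ.filter (fun q : H.reps ↦ p (heegnerFormClass hK q)) with hF
  set F' := Finset.univ.filter (fun q : H.reps ↦ p (γ⁻¹ * heegnerFormClass hK q)) with hF'
  choose e he using hθ γ
  have he_F : ∀ q ∈ F, e q ∈ F' := fun q hq ↦ by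
    rw [hF, Finset.mem_filter] at hq
    rw [hF', Finset.mem_filter]
    exact ⟨Finset.mem_univ _, by rw [(he q).1, inv_mul_cancel_left]; exact hq.2⟩
  have he_inj : Set.InjOn e F := fun q₁ _ q₂ _ h ↦ by
    have h₁ := (he q₁).1
    have h₂ := (he q₂).1
    rw [h] at h₁
    exact heegnerFormClass_injective_reps hK H (mul_left_cancel (h₁.symm.trans h₂))
  have he_surj : Set.SurjOn e F F' := by
    intro q' hq'
    rw [hF', Finset.coe_filter] at hq'
    -- the representative of class `γ⁻¹ [𝔞_{q'}]`
    choose e' he' using hθ γ⁻¹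
    refine ⟨e' q', ?_, ?_⟩
    · rw [hF, Finset.coe_filter]
      exact ⟨Finset.mem_univ _, by rw [(he' q').1]; exact hq'.2⟩
    · apply heegnerFormClass_injective_reps hK H
      simp only [(he _).1, (he' q').1, mul_inv_cancel_left]
  rw [map_sum]
  calc ∑ q ∈ F, Affine.Point.map (θ γ : singularModuliField K ι →ₐ[K] singularModuliField K ι) (P q)
      = ∑ q ∈ F, P (e q) := Finset.sum_congr rfl fun q _ ↦ (he q).2
    _ = ∑ q ∈ F', P q := Finset.sum_nbij e he_F he_inj he_surj (fun _ _ ↦ rfl)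

/-- In a group with a subgroup of index `2`, the complement of the subgroup is the other coset. [folklore] -/
theorem not_mem_iff_mul_inv_mem_of_index_two {G : Type*} [CommGroup G] {S : Subgroup G} (hS : S.index = 2) {γ₀ : G}
    (hγ₀ : γ₀ ∉ S) (c : G) : c ∉ S ↔ c * γ₀⁻¹ ∈ S := by
  rw [Subgroup.mul_mem_iff_of_index_two hS, inv_mem_iff]
  tauto

/-- the coset `Cl²·γ₀` as the complement of `Cl²` (index `2`). [folklore] -/
theorem exists_sq_mul_iff_not_exists_sq {G : Type*} [CommGroup G]
    (hS : (powMonoidHom 2 : G →* G).range.index = 2) {γ₀ : G} (hγ₀ : ∀ δ : G, γ₀ ≠ δ ^ 2) (c : G) :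
    (∃ δ, c = δ ^ 2 * γ₀) ↔ ¬ ∃ δ, c = δ ^ 2 * 1 := by
  have hγ₀' : γ₀ ∉ (powMonoidHom 2 : G →* G).range := by
    rintro ⟨δ, hδ⟩
    exact hγ₀ δ (by rw [← hδ, powMonoidHom_apply])
  constructor
  · rintro ⟨δ, rfl⟩ ⟨δ', h⟩
    refine hγ₀ (δ' * δ⁻¹) ?_
    rw [mul_one] at h
    rw [mul_pow, inv_pow, ← h, mul_comm (δ ^ 2) γ₀, mul_inv_cancel_right]
  · intro h
    have h' : c ∉ (powMonoidHom 2 : G →* G).range := by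
      rintro ⟨δ, hδ⟩
      exact h ⟨δ, by rw [← hδ, powMonoidHom_apply, mul_one]⟩
    obtain ⟨δ, hδ⟩ := (not_mem_iff_mul_inv_mem_of_index_two hS hγ₀' c).mp h'
    rw [powMonoidHom_apply] at hδ
    exact ⟨δ, by rw [hδ, inv_mul_cancel_right]⟩

/-- **The trace is the half-trace plus its `θ(γ₀)`-conjugate**: `Σ_q P_q = z + θ(γ₀) z` for `z = Σ_{[𝔞_q] ∈ Cl²} P_q`
and `γ₀ ∉ Cl²`, when `[Cl : Cl²] = 2`. [cite: Cox2013, §3.B] -/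
theorem sum_eq_halfTrace_add_map (hK : IsImaginaryQuadratic K) (H : HeegnerDatum N (NumberField.discr K))
    (ι : K →+* ℂ) (P : H.reps → (W.baseChange (singularModuliField K ι)).toAffine.Point)
    (θ : ClassGroup (OrderCl.QO hK.negDiscr) ≃* Gal(singularModuliField K ι/K))
    (hθ : ∀ (γ : ClassGroup (OrderCl.QO hK.negDiscr)) (q : H.reps), ∃ q' : H.reps,
      heegnerFormClass hK q' = γ * heegnerFormClass hK q ∧
      Affine.Point.map (θ γ : singularModuliField K ι →ₐ[K] singularModuliField K ι) (P q) = P q')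
    (hS : (powMonoidHom 2 : ClassGroup (OrderCl.QO hK.negDiscr) →* _).range.index = 2)
    {γ₀ : ClassGroup (OrderCl.QO hK.negDiscr)} (hγ₀ : ∀ δ, γ₀ ≠ δ ^ 2) :
    ∑ q, P q = (∑ q ∈ Finset.univ.filter (fun q : H.reps ↦ ∃ δ, heegnerFormClass hK q = δ ^ 2 * 1), P q) +
      Affine.Point.map (θ γ₀ : singularModuliField K ι →ₐ[K] singularModuliField K ι)
        (∑ q ∈ Finset.univ.filter (fun q : H.reps ↦ ∃ δ, heegnerFormClass hK q = δ ^ 2 * 1), P q) := by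
  rw [map_sum_filter_eq_sum_filter_inv_mul hK H ι P θ hθ γ₀ (fun c ↦ ∃ δ, c = δ ^ 2 * 1)]
  rw [← Finset.sum_filter_add_sum_filter_not Finset.univ (fun q : H.reps ↦ ∃ δ, heegnerFormClass hK q = δ ^ 2 * 1)]
  congr 1
  apply Finset.sum_congr _ (fun _ _ ↦ rfl)
  ext q
  simp only [Finset.mem_filter, Finset.mem_univ, true_and]
  rw [← exists_sq_mul_iff_not_exists_sq hS hγ₀]
  constructor
  · rintro ⟨δ, h⟩
    exact ⟨δ, by rw [h, mul_one, mul_comm (δ ^ 2) γ₀, inv_mul_cancel_left]⟩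
  · rintro ⟨δ, h⟩
    refine ⟨δ, ?_⟩
    rw [mul_one] at h
    calc heegnerFormClass hK q = γ₀ * (γ₀⁻¹ * heegnerFormClass hK q) := (mul_inv_cancel_left _ _).symm
      _ = γ₀ * δ ^ 2 := by rw [h]
      _ = δ ^ 2 * γ₀ := mul_comm _ _


/-- the partial sums of lifts map to the partial Heegner sums in `E(ℂ)`. [folklore] -/
theorem map_sum_filter_lifts [NeZero N] (H : HeegnerDatum N (NumberField.discr K)) (ι : K →+* ℂ)
    (Dt : ModularParametrizationData W N) (P : H.reps → (W.baseChange (singularModuliField K ι)).toAffine.Point)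
    (hP : ∀ q : H.reps, Affine.Point.map (singularModuliField K ι).subtype.toRatAlgHom (P q) = Dt.φ (heegnerTau q))
    (p : ℤ × ℤ × ℤ → Prop) :
    Affine.Point.map (singularModuliField K ι).subtype.toRatAlgHom
        (∑ q ∈ Finset.univ.filter (fun q : H.reps ↦ p q), P q) =
      ∑ Q ∈ H.reps.filter p, Dt.φ (heegnerTau Q) := by
  rw [map_sum]
  simp_rw [hP]
  rw [Finset.sum_filter, Finset.sum_filter]
  exact Finset.sum_coe_sort H.reps (fun Q ↦ if p Q then Dt.φ (heegnerTau Q) else 0)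

/-- the number of representatives whose class is a square is `#Cl²`. [cite: Gross1984, §I.1] -/
theorem card_filter_sq_eq (hK : IsImaginaryQuadratic K) (H : HeegnerDatum N (NumberField.discr K))
    (hbij : Function.Bijective fun q : H.reps ↦ heegnerFormClass hK q) :
    (H.reps.filter (fun Q ↦ ∃ δ, heegnerFormClass hK Q = δ ^ 2 * 1)).card =
      Nat.card ((powMonoidHom 2 : ClassGroup (OrderCl.QO hK.negDiscr) →* _).range) := by
  rw [← Nat.card_eq_finsetCard]
  symm
  obtain ⟨g, hg⟩ := hbij.2.hasRightInverse
  have hg' : ∀ c, heegnerFormClass hK (g c : ℤ × ℤ × ℤ) = c := fun c ↦ hg c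
  refine Nat.card_congr (Equiv.ofBijective (fun c ↦ ⟨(g c.1 : ℤ × ℤ × ℤ), ?_⟩) ⟨?_, ?_⟩)
  · rw [Finset.mem_filter]
    refine ⟨Subtype.coe_prop _, ?_⟩
    obtain ⟨δ, hδ⟩ := c.2
    exact ⟨δ, by rw [hg', ← hδ, powMonoidHom_apply, mul_one]⟩
  · intro c₁ c₂ h
    have h' : (g c₁.1 : ℤ × ℤ × ℤ) = g c₂.1 := by
      have := congrArg Subtype.val h
      simpa using this
    exact Subtype.ext (hg.injective (Subtype.ext h'))
  · rintro ⟨Q, hQ⟩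
    rw [Finset.mem_filter] at hQ
    obtain ⟨δ, hδ⟩ := hQ.2
    refine ⟨⟨heegnerFormClass hK Q, ⟨δ, by rw [hδ, powMonoidHom_apply, mul_one]⟩⟩, ?_⟩
    apply Subtype.ext
    show (g (heegnerFormClass hK Q) : ℤ × ℤ × ℤ) = Q
    have h1 : heegnerFormClass hK (g (heegnerFormClass hK Q) : ℤ × ℤ × ℤ) =
        heegnerFormClass hK ((⟨Q, hQ.1⟩ : H.reps) : ℤ × ℤ × ℤ) := hg' _
    exact congrArg Subtype.val (hbij.1 h1)

/-- an odd multiple of `T` is `T`. [folklore] -/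
theorem odd_smul_eq_self_of_add_self {A : Type*} [AddCommGroup A] {T : A} (hT : T + T = 0) {m : ℕ} (hm : Odd m) :
    m • T = T := by
  obtain ⟨j, rfl⟩ := hm
  rw [add_smul, one_smul, mul_comm, mul_smul, two_smul, hT, smul_zero, zero_add]

/-- `T` is fixed by every algebra map (rational coordinates). [folklore] -/
theorem map_cm7_T {F L L' : Type*} [Field F] [Field L] [Field L'] [CharZero F] [CharZero L] [CharZero L']
    [Algebra F L] [Algebra F L'] (f : L →ₐ[F] L') :
    Affine.Point.map f (Affine.Point.some 2 (-1) (nonsingular_cm7_baseChange_two_neg_one L) :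
      (cm7.baseChange L).toAffine.Point) = Affine.Point.some 2 (-1) (nonsingular_cm7_baseChange_two_neg_one L') := by
  rw [Affine.Point.map_some, Affine.Point.some.injEq]
  exact ⟨by rw [map_ofNat], by rw [map_neg, map_one]⟩

/-- **The half-trace relation in `E(ℂ)`**: with Fricke sign `-1`, `#Cl²` odd and `φ(0) = T`, the lifted half-trace
`Z = Σ_{[𝔞_Q] ∈ Cl²} φ(τ_Q)` satisfies `Z + conj Z = T`. [cite: GrossLMS1991, Prop. 5.3 and proof] -/
theorem halfTrace_add_conj_eq_T [NeZero N] [W.IsElliptic] (hK : IsImaginaryQuadratic K)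
    (hH : SatisfiesHeegnerHypothesis N K) (Dt : ModularParametrizationData W N)
    (H : HeegnerDatum N (NumberField.discr K)) (hW : ModularForms.IsFrickeEigen N Dt.f ((-1 : ℤ) : ℂ))
    (hν : ∃ μ, heegnerFormClass hK ((N : ℤ), H.β, (H.β ^ 2 - NumberField.discr K) / (4 * N)) = μ ^ 2)
    (hbij : Function.Bijective fun q : H.reps ↦ heegnerFormClass hK q)
    (hodd : Odd (Nat.card ((powMonoidHom 2 : ClassGroup (OrderCl.QO hK.negDiscr) →* _).range)))
    {T : (W.baseChange ℂ).toAffine.Point} (hT : T + T = 0) (hcusp : Dt.cuspZeroPoint = T) :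
    (∑ Q ∈ H.reps.filter (fun Q ↦ ∃ δ, heegnerFormClass hK Q = δ ^ 2 * 1), Dt.φ (heegnerTau Q)) +
      conjPoint W (∑ Q ∈ H.reps.filter (fun Q ↦ ∃ δ, heegnerFormClass hK Q = δ ^ 2 * 1), Dt.φ (heegnerTau Q)) = T := by
  rw [conjPoint_sum_φ_heegnerTau_sqCoset hK hH Dt H hW (Or.inr rfl) 1 hν, card_filter_sq_eq hK H hbij, hcusp,
    odd_smul_eq_self_of_add_self hT hodd]
  simp only [Int.reduceNeg, neg_smul, one_smul, sub_neg_eq_add, add_neg_cancel_left]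

end Points


/-! ## §7 Transport lemmas for `Affine.Point.map` -/

section Transport

/-- `Point.map` only depends on the underlying function. [folklore] -/
theorem affinePoint_map_congr {R S S' A B : Type*} [CommRing R] [CommRing S] [CommRing S'] [Field A] [Field B]
    [Algebra R S] [Algebra R S'] [Algebra R A] [Algebra S A] [IsScalarTower R S A] [Algebra R B] [Algebra S B]
    [IsScalarTower R S B] [Algebra S' A] [IsScalarTower R S' A] [Algebra S' B] [IsScalarTower R S' B]
    {W : WeierstrassCurve R} (f : A →ₐ[S] B) (g : A →ₐ[S'] B) (h : ∀ x, f x = g x)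
    (P : (W.baseChange A).toAffine.Point) : Affine.Point.map f P = Affine.Point.map g P := by
  rcases P with _ | ⟨x, y, hP⟩
  · rfl
  · rw [Affine.Point.map_some, Affine.Point.map_some, Affine.Point.some.injEq]
    exact ⟨h x, h y⟩


/-- `Point.map` along a composite, with three possibly different bases. [folklore] -/
theorem affinePoint_map_map_congr {R S S' S'' A B C : Type*} [CommRing R] [CommRing S] [CommRing S'] [CommRing S'']
    [Field A] [Field B] [Field C] [Algebra R S] [Algebra R S'] [Algebra R S'']
    [Algebra R A] [Algebra S A] [IsScalarTower R S A] [Algebra R B] [Algebra S B] [IsScalarTower R S B]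
    [Algebra S' B] [IsScalarTower R S' B] [Algebra R C] [Algebra S' C] [IsScalarTower R S' C]
    [Algebra S'' A] [IsScalarTower R S'' A] [Algebra S'' C] [IsScalarTower R S'' C]
    {W : WeierstrassCurve R} (f : A →ₐ[S] B) (g : B →ₐ[S'] C) (h : A →ₐ[S''] C) (hh : ∀ x, h x = g (f x))
    (P : (W.baseChange A).toAffine.Point) :
    Affine.Point.map h P = Affine.Point.map g (Affine.Point.map f P) := by
  rcases P with _ | ⟨x, y, hP⟩
  · rfl
  · rw [Affine.Point.map_some, Affine.Point.map_some, Affine.Point.map_some, Affine.Point.some.injEq]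
    exact ⟨hh x, hh y⟩

end Transport


end Summit.BirchSwinnertonDyer.BirchSwinnertonDyer.Theorems.GoldfeldGoodTwists

end
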